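import Summits.ResolutionOfSingularities.ResolutionOfSingularities.Theorems.PurelyInseparableDim4ResConeLayer
import HarnessLib
import HarnessLib.Audit.Tags

/-!
# Purely inseparable four-folds — THE MONOMIAL PHASE IS EMPTY: no isolated `Step0 p` chain with
# `x^{r₀} ∣ F₀` keeps the shade `0` (every prime)

[OURS · counted 0 · cell `res-dim4-pi` · seat res-dim4-p-12 g2 · K2(p) lane (desk WORD #66 (2)).]  Nothing
here proves K2(p), `NoIsolatedTrap p p` or resolution of singularities in dimension ≥ 4 / characteristic `p`.

Shade `0` means `ord₀ F = |r|`, i.e. the initial form of `F` is the boundary monomial `x^r` (the residual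
cone `resForm s` is a constant, its polar kernel is everything: `e_G = 4`).  Two elementary facts:
* `degree_lt_apply_add_of_isIsolated` — at an ISOLATED `q`-fold state with `x^r ∣ F`, every three of the
  four multiplicities sum to `≤ q − 1` (`|r| < r_j + q` for every `j`): otherwise the `x_j`-axis is `q`-fold
  (`BandLayers.not_isIsolated_of_three_layers`);
* `ordZero_step_lt_of_shade_zero` — at a point step that keeps the shade `0`, the order DROPS:
  `ord₀ F′ = |r′| = (o − q) + Σ_{i ≠ j, b_i = 0} r_i ≤ (o − q) + (q − 1) = o − 1`.
Hence **`noConstantShadeZeroTrap`**: no infinite isolated `Step0 p` chain with `x^{r₀} ∣ F₀` and shade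
identically `0` — the `d = 0` slice of K2(p) (in `BandShade.noAboveFloorTrap_iff_noConstantShadeTrap`'s form)
is empty for every prime; with FILE 3d the open residue of K2(p) is `d ≥ 1`, `e_G ∈ {2, 3, 4}`.
bears_on: LADDER-RESOLUTION:D157-DOOR2 (res-dim4-pi · K2(p)).  Supports stmt-ResolutionOfSingularities-16155
(helper).
-/

set_option linter.dupNamespace false -- mandated namespace of this single-conjunct summit

noncomputable section

namespace Summit.ResolutionOfSingularities.ResolutionOfSingularities.Theorems.PIDim4

namespace ResCone

open MvPolynomial Finset
open Literature.AlgebraicGeometry.Resolution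
open Literature.AlgebraicGeometry.Resolution.CentreBlowup
open Literature.AlgebraicGeometry.Resolution.Hauser2010
open Literature.AlgebraicGeometry.Resolution.HauserPerlega2019

variable {K : Type} [Field K]

/-- **Isolation bounds the boundary off every letter**: at an isolated `q`-fold state with `x^r ∣ F`,
`|r| < r_j + q` for every `j` (the three other multiplicities sum to `≤ q − 1`, else the `x_j`-axis is
`q`-fold). [OURS] [folklore] -/
theorem degree_lt_apply_add_of_isIsolated {q : ℕ} {s : State K} (hiso : IsIsolated q s.F)
    (hr : ∀ d ∈ s.F.support, s.r ≤ d) (j : Fin 4) : s.r.degree < s.r j + q := by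
  by_contra hle
  rw [not_lt, Finsupp.degree_eq_sum, Fin.sum_univ_four] at hle
  have hl : ∀ i, ∀ e ∈ s.F.support, s.r i ≤ e i := fun i e he => hr e he i
  have hj4 : ∀ j : Fin 4, j = 0 ∨ j = 1 ∨ j = 2 ∨ j = 3 := by decide
  rcases hj4 j with rfl | rfl | rfl | rfl
  · exact BandLayers.not_isIsolated_of_three_layers (a := 1) (b := 2) (c := 3) (hl 1) (hl 2) (hl 3) (by decide)
      (by decide) (by decide) (by omega) hiso
  · exact BandLayers.not_isIsolated_of_three_layers (a := 0) (b := 2) (c := 3) (hl 0) (hl 2) (hl 3) (by decide)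
      (by decide) (by decide) (by omega) hiso
  · exact BandLayers.not_isIsolated_of_three_layers (a := 0) (b := 1) (c := 3) (hl 0) (hl 1) (hl 3) (by decide)
      (by decide) (by decide) (by omega) hiso
  · exact BandLayers.not_isIsolated_of_three_layers (a := 0) (b := 1) (c := 2) (hl 0) (hl 1) (hl 2) (by decide)
      (by decide) (by decide) (by omega) hiso

/-- Shade `0` means `ord₀ F = |r|`. [folklore] -/
theorem ordZero_eq_degree_of_shade_zero {s : State K} {o : ℕ} (ho : ordZero s.F = o)
    (hr : ∀ d ∈ s.F.support, s.r ≤ d) (h0 : s.shade = 0) : o = s.r.degree := by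
  rw [BandShade.shade_eq_coe ho] at h0
  have h : o - s.r.degree = 0 := by exact_mod_cast h0
  have := degree_r_le ho hr
  omega

/-- **In the monomial phase the order drops**: a point step in the `x_j`-chart from a state of shade `0`
(`x^r ∣ F`, `q ≤ ord₀ F = o`, isolated) to a state of shade `0` lowers the order: `ord₀ F′ + 1 ≤ ord₀ F`.
[OURS] [folklore] -/
theorem ordZero_step_lt_of_shade_zero [DecidableEq K] {q : ℕ} (j : Fin 4) {b : Fin 4 → K}
    (hbj : b j = 0) {s : State K} (hiso : IsIsolated q s.F) {o o' : ℕ} (ho : ordZero s.F = o)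
    (hqo : q ≤ o) (hr : ∀ d ∈ s.F.support, s.r ≤ d) (h0 : s.shade = 0)
    (ho' : ordZero (CentreBlowup.step q Finset.univ j b s).F = o')
    (hr' : ∀ d ∈ (CentreBlowup.step q Finset.univ j b s).F.support,
      (CentreBlowup.step q Finset.univ j b s).r ≤ d)
    (h0' : (CentreBlowup.step q Finset.univ j b s).shade = 0) : o' + 1 ≤ o := by
  have hdeg := degree_step_r q j hbj s ho hr
  have hoo := ordZero_eq_degree_of_shade_zero ho hr h0
  have hoo' := ordZero_eq_degree_of_shade_zero ho' hr' h0'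
  have hiso' := degree_lt_apply_add_of_isIsolated hiso hr j
  have hrj : s.r j ≤ ∑ i, s.r i * (if i = j ∨ b i ≠ 0 then 1 else 0) := by
    have h := Finset.single_le_sum (f := fun i => s.r i * (if i = j ∨ b i ≠ 0 then 1 else 0))
      (fun i _ => Nat.zero_le _) (Finset.mem_univ j)
    simp only [true_or, if_true, mul_one] at h
    exact h
  omega

/-- **THE MONOMIAL PHASE IS EMPTY** (the `d = 0` slice of K2(p), every prime): there is no infinite `Step0 p`
chain of ISOLATED states with `x^{r₀} ∣ F₀` whose shade is identically `0` — the order would drop at every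
step. [OURS] [folklore] -/
theorem noConstantShadeZeroTrap (p : ℕ) [Fact p.Prime] :
    ∀ (K : Type) [Field K] [DecidableEq K],
      ¬ ∃ c : ℕ → State K, (∀ e ∈ (c 0).F.support, (c 0).r ≤ e) ∧
        ∀ k, IsIsolated p (c k).F ∧ Step0 p (c k) (c (k + 1)) ∧ (c k).shade = 0 := by
  intro K _ _
  rintro ⟨c, hr0, hc⟩
  have hc2 : ∀ k, IsIsolated p (c k).F ∧ Step0 p (c k) (c (k + 1)) := fun k => ⟨(hc k).1, (hc k).2.1⟩
  have hr := IsolatedBand.isolated_chain_forall_le hc2 hr0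
  choose o ho hpo _ using BandShade.exists_ordZero_eq p hc2
  obtain ⟨j, b, hw⟩ := FreeTail.exists_witnesses (K := K) (fun k => (hc k).2.1)
  have hdrop : ∀ k, o (k + 1) + 1 ≤ o k := by
    intro k
    obtain ⟨-, hbk, -, -, hck⟩ := hw k
    have ho' : ordZero (CentreBlowup.step p Finset.univ (j k) (b k) (c k)).F = o (k + 1) := by
      rw [← hck]; exact ho (k + 1)
    have hr' : ∀ d ∈ (CentreBlowup.step p Finset.univ (j k) (b k) (c k)).F.support,
        (CentreBlowup.step p Finset.univ (j k) (b k) (c k)).r ≤ d := by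
      rw [← hck]; exact hr (k + 1)
    have h0' : (CentreBlowup.step p Finset.univ (j k) (b k) (c k)).shade = 0 := by
      rw [← hck]; exact (hc (k + 1)).2.2
    exact ordZero_step_lt_of_shade_zero (j k) hbk (hc k).1 (ho k) (hpo k) (hr k) (hc k).2.2 ho' hr'
      h0'
  have hle : ∀ k, o k + k ≤ o 0 := by
    intro k
    induction k with
    | zero => simp
    | succ k ih => have := hdrop k; omega
  have := hle (o 0 + 1)
  omega

/-- Hence a constant-shade isolated chain with `x^{r₀} ∣ F₀` (the K2(p) trap form of
`BandShade.noAboveFloorTrap_iff_noConstantShadeTrap`) has shade `d ≠ 0`. [OURS] [folklore] -/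
theorem shade_ne_zero_of_constantShadeTrap (p : ℕ) [Fact p.Prime] [DecidableEq K] {c : ℕ → State K}
    {d : ℕ∞} (hr0 : ∀ e ∈ (c 0).F.support, (c 0).r ≤ e)
    (hc : ∀ k, IsIsolated p (c k).F ∧ Step0 p (c k) (c (k + 1)) ∧ (c k).shade = d) : d ≠ 0 := by
  rintro rfl
  exact noConstantShadeZeroTrap p K ⟨c, hr0, hc⟩

end ResCone

end Summit.ResolutionOfSingularities.ResolutionOfSingularities.Theorems.PIDim4

end
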